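import Literature.NumberTheory.GaloisRepresentations.ContinuousShapiroLift
import Literature.NumberTheory.GaloisRepresentations.ContinuousCupProductCompatMixed
import HarnessLib

/-!
# The finite coinduced representation `Maps(G ⧸ N, X)`: change of subgroup (pull-back and fibre sum along
# `G ⧸ N' → G ⧸ N`), the SUMMED PAIRING `⟨φ, ψ⟩ = Σ_{y ∈ G/N} ⟨φ(y), ψ(y)⟩`, and their adjointness under the
# cup product — companion of `ContinuousShapiroLift.lean`

Generic continuous group cohomology (no number theory); namespace `Literature.NumberTheory.GaloisRepresentations`.
Definitions with bodies and theorems; NO named fact, no `sorry`, no instance, no notation.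

Let `G` be a topological group, `X, Y, Z : TopRep R G` topological representations and `N' ≤ N ≤ G` subgroups.  On
the tree's `coindFin X N = Maps(G ⧸ N, X)` with the diagonal action `(g ⋆ φ)(y) = g • φ(g⁻¹ • y)`
(`ContinuousShapiroLift.lean`; Serre, *Local Fields* VII §6; Neukirch–Schmidt–Wingberg I §6 «induced modules»):

* §1 `coindFinRes X h : Maps(G ⧸ N, X) ⟶ Maps(G ⧸ N', X)`, `φ ↦ φ ∘ π` (`π : G ⧸ N' → G ⧸ N`), and
  `coindFinSum X h : Maps(G ⧸ N', X) ⟶ Maps(G ⧸ N, X)`, `(Σ ψ)(y) = Σ_{π z = y} ψ(z)` (the «norm» of the pair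
  `Ind_{N'} ⊇ Ind_N`), both `G`-equivariant (`TopRep` morphisms);
* §2 for a continuous equivariant pairing `P : X × Y → Z` (`ContPairing`) and `N` of finite index, the SUMMED
  PAIRING `P.coindFin N : Maps(G ⧸ N, X) × Maps(G ⧸ N, Y) → Z`, `⟨φ, ψ⟩_N = Σ_{y} P(φ(y), ψ(y))` (continuous,
  `R`-bilinear, `G`-equivariant: a `ContPairing`), with the two module identities
  **`⟨Σ ψ', φ⟩_N = ⟨ψ', φ ∘ π⟩_{N'}`** / **`⟨φ, Σ ψ'⟩_N = ⟨φ ∘ π, ψ'⟩_{N'}`** (`toLin_coindFinSum_left/right`: the fibre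
  sum is ADJOINT to the pull-back — the module-level form of the projection formula `cor(a ∪ res b) = cor a ∪ b`,
  NSW (1.5.3)(iv)) and **`⟨R_c φ, R_c ψ⟩_N = ⟨φ, ψ⟩_N`** for the right translations `R_c` (`rTransHom`, `N` normal);
* §3 the cohomological consequences for the cup product `H¹ × H¹ → H²` of `ContinuousCupProduct.lean`
  (via the tree's naturalities `ContPairing.cupProduct_map_adjoint`, `ContPairing.cupProduct_map`):
  **`H¹(Σ) a' ∪_N b = a' ∪_{N'} H¹(∘π) b`** (`cupProduct_coindFinSum_left`), its mirror image, and
  **`H¹(R_c) a ∪_N H¹(R_c) b = a ∪_N b`** (`cupProduct_rTransHom`);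
* §4 the Shapiro lifts of `ContinuousShapiroLift.lean` under pull-back: `evalOne_{N'} (Sh_N(f) ∘ π) = f|_{N'}` ON
  COCYCLES (`evalOne_pullback_coindFinRes_shapiroCocycle`), hence on classes
  **`H¹(∘π) [Sh_N f] = [Sh_{N'} (f|_{N'})]`** (`cohomologyMap_coindFinRes_shapiroCocycle`: the Shapiro
  isomorphism intertwines the pull-back `Maps(G/N, X) → Maps(G/N', X)` with the restriction `H¹(N, X) → H¹(N', X)`).

Why (consumer).  In the Shapiro model of the cohomology of the layers `U_n = Gal(K̄_v/K_{n,v})` of a `ℤ_p`-tower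
(`H¹(U_n, M) ≅ H¹(Γ_{K_v}, Maps(Γ_{K_v} ⧸ U_n, M))`), the `T_pE`-adic local Tate pairing at layer `n` (crux K3
`SignedKatoDivisibilityUpToAtTwo` of `Summits/BirchSwinnertonDyer`, definition item (D-layer) of line `colemanrat`)
is `inv_v(Sh⁻¹ x ∪_{⟨,⟩_n} Sh⁻¹ y)` for the summed Weil pairing; §2–§4 are the algebra of its projection formula
(P1) across layers and of its Galois invariance (P2) (`conjMap_evalOne_eq`: conjugation = right translation).

## References

* J.-P. Serre, *Local Fields* (1979), VII §5–§6 (the action of `G/H`; induced modules and Shapiro's lemma).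
  [SerreLocalFields1979]
* J. Neukirch, A. Schmidt, K. Wingberg, *Cohomology of Number Fields*, 2nd ed. (2008), I §4 (1.4.2) (naturality of
  cup products), I §5 Prop. (1.5.3)(iv) (projection formula), I §6 Prop. (1.6.4) (Shapiro). [NeukirchSchmidtWingberg2008]
-/

noncomputable section

open CategoryTheory

open scoped Classical

universe u v

namespace Literature.NumberTheory.GaloisRepresentations

open _root_.TopRep
open Literature.NumberTheory.EllipticCurves (subgroupInclusion)

variable {R : Type u} [CommRing R] [TopologicalSpace R]
variable {G : Type v} [Group G] [TopologicalSpace G] [IsTopologicalGroup G]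

/-! ## §1 Change of subgroup: pull-back and fibre sum along `G ⧸ N' → G ⧸ N` -/

section ChangeOfSubgroup

variable (X : TopRep.{v} R G) {N N' : Subgroup G} (h : N' ≤ N)

omit [TopologicalSpace G] [IsTopologicalGroup G] in
/-- The projection `π : G ⧸ N' → G ⧸ N` (`N' ≤ N`) is `G`-equivariant. [cite: NeukirchSchmidtWingberg2008, I §5 (coset spaces)] -/
theorem quotientMapOfLE_smul (g : G) (z : G ⧸ N') :
    Subgroup.quotientMapOfLE h (g • z) = g • Subgroup.quotientMapOfLE h z := by
  induction z using QuotientGroup.induction_on with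
  | H a => rw [MulAction.Quotient.smul_coe, Subgroup.quotientMapOfLE_apply_mk, Subgroup.quotientMapOfLE_apply_mk,
      MulAction.Quotient.smul_coe]

/-- **Pull-back along `π : G ⧸ N' → G ⧸ N`**: `Maps(G ⧸ N, X) ⟶ Maps(G ⧸ N', X)`, `φ ↦ φ ∘ π` — under Shapiro the
RESTRICTION `H¹(N, X) → H¹(N', X)` (§4). A morphism of topological representations (`π` is equivariant).
[cite: NeukirchSchmidtWingberg2008, I §6 (induced modules)] -/
def coindFinRes : coindFin X N ⟶ coindFin X N' :=
  TopRep.ofHom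
    { toContinuousLinearMap :=
        { toFun := fun φ => fun z => φ (Subgroup.quotientMapOfLE h z)
          map_add' := fun _ _ => rfl
          map_smul' := fun _ _ => rfl
          cont := continuous_pi fun z => continuous_apply _ }
      isIntertwining' := fun g => by
        ext φ z
        change (coindFin X N).ρ g φ (Subgroup.quotientMapOfLE h z) = X.ρ g (φ (Subgroup.quotientMapOfLE h (g⁻¹ • z)))
        rw [coindFin_ρ_apply, quotientMapOfLE_smul] }

omit [TopologicalSpace G] [IsTopologicalGroup G] in
/-- Values of `coindFinRes`: `(φ ∘ π)(z) = φ(π z)`. [cite: NeukirchSchmidtWingberg2008, I §6 (induced modules)] -/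
@[simp]
theorem coindFinRes_apply (φ : coindFin X N) (z : G ⧸ N') :
    (coindFinRes X h).hom φ z = φ (Subgroup.quotientMapOfLE h z) :=
  rfl

variable [Fintype (G ⧸ N')]

/-- **Fibre sum along `π : G ⧸ N' → G ⧸ N`**: `Maps(G ⧸ N', X) ⟶ Maps(G ⧸ N, X)`, `(Σ ψ)(y) = Σ_{π z = y} ψ(z)` —
under Shapiro the CORESTRICTION `H¹(N', X) → H¹(N, X)` (the relative norm of `Ind_{N'} ⊇ Ind_N`). A morphism of
topological representations. [cite: NeukirchSchmidtWingberg2008, I §5–§6] -/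
def coindFinSum : coindFin X N' ⟶ coindFin X N :=
  TopRep.ofHom
    { toContinuousLinearMap :=
        { toFun := fun ψ => fun y => ∑ z : G ⧸ N', if Subgroup.quotientMapOfLE h z = y then ψ z else 0
          map_add' := fun ψ ψ' => by
            ext y
            change (∑ z : G ⧸ N', if Subgroup.quotientMapOfLE h z = y then (ψ + ψ') z else 0) =
              (∑ z : G ⧸ N', if Subgroup.quotientMapOfLE h z = y then ψ z else 0) +
                ∑ z : G ⧸ N', if Subgroup.quotientMapOfLE h z = y then ψ' z else 0
            rw [← Finset.sum_add_distrib]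
            exact Finset.sum_congr rfl fun z _ => by split_ifs <;> simp
          map_smul' := fun r ψ => by
            ext y
            change (∑ z : G ⧸ N', if Subgroup.quotientMapOfLE h z = y then (r • ψ) z else 0) =
              r • ∑ z : G ⧸ N', if Subgroup.quotientMapOfLE h z = y then ψ z else 0
            rw [Finset.smul_sum]
            exact Finset.sum_congr rfl fun z _ => by split_ifs <;> simp
          cont := continuous_pi fun y => continuous_finsetSum _ fun z _ =>
            continuous_if_const _ (fun _ => continuous_apply z) fun _ => continuous_const }
      isIntertwining' := fun g => by
        ext ψ y
        change (∑ z : G ⧸ N', if Subgroup.quotientMapOfLE h z = y then (coindFin X N').ρ g ψ z else 0) =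
          X.ρ g (∑ z : G ⧸ N', if Subgroup.quotientMapOfLE h z = g⁻¹ • y then ψ z else 0)
        rw [map_sum, ← Equiv.sum_comp (MulAction.toPerm g)
          (fun z => if Subgroup.quotientMapOfLE h z = y then (coindFin X N').ρ g ψ z else 0)]
        refine Finset.sum_congr rfl fun z _ => ?_
        have hiff : Subgroup.quotientMapOfLE h (g • z) = y ↔ Subgroup.quotientMapOfLE h z = g⁻¹ • y := by
          rw [quotientMapOfLE_smul, ← eq_inv_smul_iff]
        simp only [MulAction.toPerm_apply, coindFin_ρ_apply, inv_smul_smul]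
        by_cases hz : Subgroup.quotientMapOfLE h z = g⁻¹ • y
        · rw [if_pos (hiff.2 hz), if_pos hz]
        · rw [if_neg (fun h' => hz (hiff.1 h')), if_neg hz, map_zero] }

omit [TopologicalSpace G] [IsTopologicalGroup G] in
/-- Values of `coindFinSum`: `(Σ ψ)(y) = Σ_{z : π z = y} ψ(z)`. [cite: NeukirchSchmidtWingberg2008, I §5–§6] -/
theorem coindFinSum_apply (ψ : coindFin X N') (y : G ⧸ N) :
    (coindFinSum X h).hom ψ y = ∑ z : G ⧸ N', if Subgroup.quotientMapOfLE h z = y then ψ z else 0 :=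
  rfl

end ChangeOfSubgroup

/-! ## §2 The summed pairing on `Maps(G ⧸ N, ·)` -/

namespace ContPairing

variable {X Y Z : TopRep.{v} R G} (P : ContPairing X Y Z) (N : Subgroup G) [Fintype (G ⧸ N)]

/-- **The summed pairing** `⟨φ, ψ⟩_N = Σ_{y ∈ G/N} P(φ(y), ψ(y)) : Maps(G ⧸ N, X) × Maps(G ⧸ N, Y) → Z` attached to
a continuous equivariant pairing `P : X × Y → Z`: continuous, `R`-bilinear and `G`-equivariant (reindex the sum
by `y ↦ g • y`). Under Shapiro it is the pairing whose cup product computes `cor(x ∪ y)` on `H¹(N, ·)`.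
[cite: NeukirchSchmidtWingberg2008, I §5 Prop. (1.5.3)(iv)] [cite: SerreLocalFields1979, VII §6] -/
def coindFin : ContPairing (coindFin X N) (coindFin Y N) Z where
  toLin := LinearMap.mk₂ R (fun φ ψ => ∑ y : G ⧸ N, P.toLin (φ y) (ψ y))
    (fun φ φ' ψ => by
      rw [← Finset.sum_add_distrib]
      exact Finset.sum_congr rfl fun y _ => by rw [coindFin_add_apply, map_add, LinearMap.add_apply])
    (fun r φ ψ => by
      rw [Finset.smul_sum]
      exact Finset.sum_congr rfl fun y _ => by
        change P.toLin (r • φ y) (ψ y) = r • P.toLin (φ y) (ψ y)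
        rw [map_smul, LinearMap.smul_apply])
    (fun φ ψ ψ' => by
      rw [← Finset.sum_add_distrib]
      exact Finset.sum_congr rfl fun y _ => by rw [coindFin_add_apply, map_add])
    (fun r φ ψ => by
      rw [Finset.smul_sum]
      exact Finset.sum_congr rfl fun y _ => by
        change P.toLin (φ y) (r • ψ y) = r • P.toLin (φ y) (ψ y)
        rw [map_smul])
  continuous_toLin := by
    change Continuous fun p : (G ⧸ N → X) × (G ⧸ N → Y) => ∑ y : G ⧸ N, P.toLin (p.1 y) (p.2 y)
    exact continuous_finsetSum _ fun y _ =>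
      Continuous.comp (f := fun p : (G ⧸ N → X) × (G ⧸ N → Y) => (p.1 y, p.2 y)) P.continuous_toLin
        (((continuous_apply y).comp continuous_fst).prodMk ((continuous_apply y).comp continuous_snd))
  toLin_smul g φ ψ := by
    change (∑ y : G ⧸ N, P.toLin ((_root_.Literature.NumberTheory.GaloisRepresentations.coindFin X N).ρ g φ y)
        ((_root_.Literature.NumberTheory.GaloisRepresentations.coindFin Y N).ρ g ψ y)) =
      Z.ρ g (∑ y : G ⧸ N, P.toLin (φ y) (ψ y))
    rw [map_sum, ← Equiv.sum_comp (MulAction.toPerm g⁻¹) (fun y => Z.ρ g (P.toLin (φ y) (ψ y)))]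
    refine Finset.sum_congr rfl fun y _ => ?_
    simp only [coindFin_ρ_apply, P.toLin_smul, MulAction.toPerm_apply]

omit [TopologicalSpace G] [IsTopologicalGroup G] in
/-- Values of the summed pairing. [cite: NeukirchSchmidtWingberg2008, I §5 Prop. (1.5.3)(iv)] -/
@[simp]
theorem coindFin_toLin_apply (φ : _root_.Literature.NumberTheory.GaloisRepresentations.coindFin X N)
    (ψ : _root_.Literature.NumberTheory.GaloisRepresentations.coindFin Y N) :
    (P.coindFin N).toLin φ ψ = ∑ y : G ⧸ N, P.toLin (φ y) (ψ y) :=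
  rfl

variable {N} {N' : Subgroup G} (h : N' ≤ N) [Fintype (G ⧸ N')]

omit [TopologicalSpace G] [IsTopologicalGroup G] in
/-- **Adjointness of fibre sum and pull-back, first slot**: `⟨Σ ψ', φ⟩_N = ⟨ψ', φ ∘ π⟩_{N'}` — the module-level
projection formula. [cite: NeukirchSchmidtWingberg2008, I §5 Prop. (1.5.3)(iv)] -/
theorem toLin_coindFinSum_left (ψ' : _root_.Literature.NumberTheory.GaloisRepresentations.coindFin X N')
    (φ : _root_.Literature.NumberTheory.GaloisRepresentations.coindFin Y N) :
    (P.coindFin N).toLin ((coindFinSum X h).hom ψ') φ = (P.coindFin N').toLin ψ' ((coindFinRes Y h).hom φ) := by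
  rw [coindFin_toLin_apply, coindFin_toLin_apply]
  have hstep : ∀ y : G ⧸ N, P.toLin ((coindFinSum X h).hom ψ' y) (φ y) =
      ∑ z : G ⧸ N', if Subgroup.quotientMapOfLE h z = y then P.toLin (ψ' z) ((coindFinRes Y h).hom φ z) else 0 := by
    intro y
    rw [coindFinSum_apply, map_sum, LinearMap.sum_apply]
    refine Finset.sum_congr rfl fun z _ => ?_
    by_cases hz : Subgroup.quotientMapOfLE h z = y
    · rw [if_pos hz, if_pos hz, coindFinRes_apply, hz]
    · rw [if_neg hz, if_neg hz, map_zero, LinearMap.zero_apply]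
  simp_rw [hstep]
  rw [Finset.sum_comm]
  refine Finset.sum_congr rfl fun z _ => ?_
  rw [Finset.sum_ite_eq Finset.univ (Subgroup.quotientMapOfLE h z) (fun _ => P.toLin (ψ' z) ((coindFinRes Y h).hom φ z)),
    if_pos (Finset.mem_univ _)]

omit [TopologicalSpace G] [IsTopologicalGroup G] in
/-- **Adjointness of fibre sum and pull-back, second slot**: `⟨φ, Σ ψ'⟩_N = ⟨φ ∘ π, ψ'⟩_{N'}`.
[cite: NeukirchSchmidtWingberg2008, I §5 Prop. (1.5.3)(iv)] -/
theorem toLin_coindFinSum_right (φ : _root_.Literature.NumberTheory.GaloisRepresentations.coindFin X N)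
    (ψ' : _root_.Literature.NumberTheory.GaloisRepresentations.coindFin Y N') :
    (P.coindFin N).toLin φ ((coindFinSum Y h).hom ψ') = (P.coindFin N').toLin ((coindFinRes X h).hom φ) ψ' := by
  rw [coindFin_toLin_apply, coindFin_toLin_apply]
  have hstep : ∀ y : G ⧸ N, P.toLin (φ y) ((coindFinSum Y h).hom ψ' y) =
      ∑ z : G ⧸ N', if Subgroup.quotientMapOfLE h z = y then P.toLin ((coindFinRes X h).hom φ z) (ψ' z) else 0 := by
    intro y
    rw [coindFinSum_apply, map_sum]
    refine Finset.sum_congr rfl fun z _ => ?_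
    by_cases hz : Subgroup.quotientMapOfLE h z = y
    · rw [if_pos hz, if_pos hz, coindFinRes_apply, hz]
    · rw [if_neg hz, if_neg hz, map_zero]
  simp_rw [hstep]
  rw [Finset.sum_comm]
  refine Finset.sum_congr rfl fun z _ => ?_
  rw [Finset.sum_ite_eq Finset.univ (Subgroup.quotientMapOfLE h z) (fun _ => P.toLin ((coindFinRes X h).hom φ z) (ψ' z)),
    if_pos (Finset.mem_univ _)]

omit [TopologicalSpace G] [IsTopologicalGroup G] in
/-- **The summed pairing is invariant under right translation**: `⟨R_c φ, R_c ψ⟩_N = ⟨φ, ψ⟩_N` (`N` normal; reindex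
`y ↦ y c`). Under Shapiro, right translation by `γN` is the conjugation action of `γ` on `H¹(N, ·)`
(`conjMap_evalOne_eq`), so this is the algebra of the Galois invariance of the layer pairings.
[cite: SerreLocalFields1979, VII §5] -/
theorem toLin_rTransHom [N.Normal] (c : G ⧸ N) (φ : _root_.Literature.NumberTheory.GaloisRepresentations.coindFin X N)
    (ψ : _root_.Literature.NumberTheory.GaloisRepresentations.coindFin Y N) :
    (P.coindFin N).toLin ((rTransHom X N c).hom φ) ((rTransHom Y N c).hom ψ) = (P.coindFin N).toLin φ ψ := by
  rw [coindFin_toLin_apply, coindFin_toLin_apply]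
  simp_rw [rTransHom_apply]
  exact Equiv.sum_comp (Equiv.mulRight c) (fun y => P.toLin (φ y) (ψ y))

/-! ## §3 Consequences for the cup product `H¹ × H¹ → H²` -/

variable [LocallyCompactSpace G]

/-- **`H¹(Σ) a' ∪_N b = a' ∪_{N'} H¹(∘π) b`**: the fibre sum in the first slot is adjoint to the pull-back in the
second under the cup products of the summed pairings (tree `ContPairing.cupProduct_map_adjoint` with the module
identity `toLin_coindFinSum_left`; the cohomological projection formula `cor(a' ∪ res b) = cor a' ∪ b` in Shapiro
form). [cite: NeukirchSchmidtWingberg2008, I §5 Prop. (1.5.3)(iv)] -/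
theorem cupProduct_coindFinSum_left
    (a' : continuousCohomology 1 (_root_.Literature.NumberTheory.GaloisRepresentations.coindFin X N'))
    (b : continuousCohomology 1 (_root_.Literature.NumberTheory.GaloisRepresentations.coindFin Y N)) :
    cohomologyMap (𝟙 Z) 2 ((P.coindFin N).cupProduct (cohomologyMap (coindFinSum X h) 1 a') b) =
      (P.coindFin N').cupProduct a' (cohomologyMap (coindFinRes Y h) 1 b) :=
  cupProduct_map_adjoint (P.coindFin N) (P.coindFin N') (coindFinSum X h) (coindFinRes Y h) (𝟙 Z)
    (fun ψ' φ => P.toLin_coindFinSum_left h ψ' φ) a' b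

/-- **`H¹(R_c) a ∪_N H¹(R_c) b = a ∪_N b`** (`N` normal): the cup product of the summed pairing is invariant under
the right translations (tree `ContPairing.cupProduct_map` with `toLin_rTransHom`). Combined with
`conjMap_evalOne_eq` this is the invariance of `cor(x ∪ y)` under the conjugation action on `H¹(N, ·)`.
[cite: SerreLocalFields1979, VII §5] [cite: NeukirchSchmidtWingberg2008, I §4 (1.4.2)] -/
theorem cupProduct_rTransHom [N.Normal] (c : G ⧸ N)
    (a : continuousCohomology 1 (_root_.Literature.NumberTheory.GaloisRepresentations.coindFin X N))
    (b : continuousCohomology 1 (_root_.Literature.NumberTheory.GaloisRepresentations.coindFin Y N)) :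
    (P.coindFin N).cupProduct (cohomologyMap (rTransHom X N c) 1 a) (cohomologyMap (rTransHom Y N c) 1 b) =
      cohomologyMap (𝟙 Z) 2 ((P.coindFin N).cupProduct a b) :=
  (cupProduct_map (P.coindFin N) (P.coindFin N) (rTransHom X N c) (rTransHom Y N c) (𝟙 Z)
    (fun φ ψ => (P.toLin_rTransHom c φ ψ).symm) a b).symm

end ContPairing

/-! ## §4 The Shapiro lift under pull-back: `H¹(∘π) [Sh_N f] = [Sh_{N'} (f|_{N'})]` -/

section ShapiroRes

variable (X : TopRep.{v} R G) {N N' : Subgroup G} (h : N' ≤ N)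

/-- **`evalOne_{N'} (Sh_N(f) ∘ π) = f|_{N'}` on cocycles**: evaluating the pulled-back Shapiro lift of a crossed
homomorphism `f` on `N` at the unit coset of `G ⧸ N'` gives the restriction of `f` to `N'` ON THE NOSE, for
representatives with `s(1·N) = 1` (`F(u)(π(1·N')) = F(u)(1·N) = s(1N) • f(s(1N)⁻¹ u s(u⁻¹1N)) = f(u)`).
[cite: NeukirchSchmidtWingberg2008, I §6 Prop. (1.6.4)] -/
theorem evalOne_pullback_coindFinRes_shapiroCocycle (hN : IsOpen (N : Set G)) {s : G ⧸ N → G}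
    (hs : ∀ x : G ⧸ N, (s x : G ⧸ N) = x) (hs1 : s ((1 : G) : G ⧸ N) = 1)
    (f : contOneCocycles (subgroupRep X N)) :
    evalOne X N' (contOneCocycles.pullback (ContinuousMonoidHom.id G) (resIdHom (coindFinRes X h))
        (shapiroCocycle X N hN hs f)) =
      contOneCocycles.pullback (subgroupInclusion h) (X := subgroupRep X N) (Y := subgroupRep X N')
        (TopRep.ofHom ⟨ContinuousLinearMap.id R X, fun _ => rfl⟩) f := by
  apply Subtype.ext
  ext u : 1
  rw [evalOne_apply, pullback_id_resIdHom_apply, coindFinRes_apply, Subgroup.quotientMapOfLE_apply_mk,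
    contOneCocycles.pullback_apply]
  have h1 := congr_arg (fun φ : contOneCocycles (subgroupRep X N) => φ.1 ⟨(u : G), h u.2⟩)
    (evalOne_shapiroCocycle X N hN hs hs1 f)
  exact h1

/-- **The Shapiro lifts intertwine pull-back with restriction**: `H¹(∘π) [Sh_N f] = [Sh_{N'} (f|_{N'})]` in
`H¹(G, Maps(G ⧸ N', X))` — both classes have the same evaluation `f|_{N'}` at the unit coset, and evaluation is
injective on `H¹` (`oneCocycleClass_eq_zero_of_evalOne`). [cite: NeukirchSchmidtWingberg2008, I §6 Prop. (1.6.4)] -/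
theorem cohomologyMap_coindFinRes_shapiroCocycle (hN : IsOpen (N : Set G)) (hN' : IsOpen (N' : Set G))
    {s : G ⧸ N → G} (hs : ∀ x : G ⧸ N, (s x : G ⧸ N) = x) (hs1 : s ((1 : G) : G ⧸ N) = 1)
    {s' : G ⧸ N' → G} (hs' : ∀ x : G ⧸ N', (s' x : G ⧸ N') = x) (hs'1 : s' ((1 : G) : G ⧸ N') = 1)
    (f : contOneCocycles (subgroupRep X N)) :
    cohomologyMap (coindFinRes X h) 1 (oneCocycleClass _ (shapiroCocycle X N hN hs f)) =
      oneCocycleClass _ (shapiroCocycle X N' hN' hs'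
        (contOneCocycles.pullback (subgroupInclusion h) (X := subgroupRep X N) (Y := subgroupRep X N')
          (TopRep.ofHom ⟨ContinuousLinearMap.id R X, fun _ => rfl⟩) f)) := by
  rw [cohomologyMap_oneCocycleClass, ← sub_eq_zero, ← oneCocycleClass_sub]
  refine oneCocycleClass_eq_zero_of_evalOne X N' hs' _ ?_
  rw [evalOne_sub, evalOne_pullback_coindFinRes_shapiroCocycle X h hN hs hs1 f,
    evalOne_shapiroCocycle X N' hN' hs' hs'1, sub_self, oneCocycleClass_zero]

end ShapiroRes

end Literature.NumberTheory.GaloisRepresentations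

end
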